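import Summits.BirchSwinnertonDyer.BirchSwinnertonDyer.Theorems.ByReductionTypeAtTwoMultUpperHalfGuarded
import Summits.BirchSwinnertonDyer.Rank1Residual.X5.TwoAdicTargetsMultKatoIntSplit
import HarnessLib

/-!
# Route `ByReductionTypeAtTwo`, crux `MultUpperHalfAtTwo` (item stmt-BirchSwinnertonDyer-19922): roads (v) and (vi)
# at a SPLIT multiplicative `2` — the integral door T-KATO2-SPMULT (p433154) folded into the reduction:
# SIX roads + a residual of 194 classes

HONEST FRAMING (cell `bsd-2adic`, run/shared/lean/pub/bsd-2adic/, seat `bsd-2adic-mult-2` GEN 3, D-0074 row (A)):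
research route; THEOREMS ONLY (no definition, no new named fact); nothing is booked; BSD is not proved by any of this.
PARTITION: X5@2 mult (K4ᵐ, RESIDUAL-MAP B1·O1; 1 976 book230 classes = 1 969 r0 + 7 r1) × p = 2 — types-the-object-of
(the upper half `ord₂ #Ш ≤ ord₂ #Ш_an` of item 19922 with the SPLIT integral door folded in; the residual leaf of the
line `four_roads` shrinks 759 → 194); closes none.

WHAT IS NEW. Seat `bsd-2adic-mult` GEN 7 made Theorem B of HOME/mult/PROOF-KATO2MULT.md UNCONDITIONAL
(HOME/mult/PROOF-KATO2SPLIT.md v1 @7caaefd99ad4a0cb, Lemma S proved, referee pending) and landed the door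
`X5/TwoAdicTargetsMultKatoIntSplit.lean` (p433154): the displayed `O1.KatoDivisibilityAtTwoSplitMultInt W` — for `W`
SPLIT multiplicative at `2` with `ρ_{E,2^∞}(G_ℚ) = GL₂(ℤ₂)` and `Δ_W < 0`: `X` torsion and `ι(T·g) = ϖ·L` for some
`g ∈ char_Λ X` (`T · char_Λ X ∣ L₂`, `2`-power part INCLUDED, trivial zero divided out on the analytic side) — and
the PROVED per-curve door `O1.missingUpperBoundAt_two_split_of_katoInt` (A236 + `greenberg_stevens W 2` + modularity
+ GZK + the door ⟹ `MissingUpperBoundAt W 2`; no certificate, no period datum). This file (the class-level fold the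
GEN-7 hand assigned to this seat, STATUS 09:18:17Z):

* §1 ROAD (vi) per member — the SPLIT PARITY road (twin of the non-split road (iv), p427239 / p430028): the same
  memo at slack ONE (Thm. B: `T·char X ∣ L₂^{Ω⁺_E} = c_∞·ϖ·L`, `c_∞ = 2` when `Δ > 0`), i.e. `ι(T·g) = 2ϖ·L` with
  `g ∈ char_Λ X` (binder `hK1sp`, spelled out — the tree displays only the `Δ < 0` statement), the split consumer
  `O1.upperBound_two_split_of_divisibilityRat` at `ϖ′ = 2ϖ`, `k = 1` (period `ord₂ ϖ = 0` PRINT on the irreducible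
  locus: Česnavičius + odd isogenies), then Cassels–Tate (`ord₂ #Ш` even) and the certificate «`ord₂ #Ш_an` even»
  recover the lost `2`: `missingUpperBoundAt_two_split_of_katoUpToOne_of_even`.
* §2 the CLASS theorems `missingUpperBoundAt_two_mult_of_katoIntSplitMember` (road v: one member split ∧ surjective ∧
  `Δ < 0`; twin of p424960's `…_of_katoIntMember`) and `missingUpperBoundAt_two_mult_of_katoUpToOneSplitMember`
  (road vi: one member split ∧ surjective ∧ `ord₂ #Ш_an` even).
* §3 **`multUpperHalfAtTwo_of_sixRoads_of_eulerChar`** — the FULLY-QUALIFIED route decl ⟸ PRINT ×7 {A236 `h41sp`,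
  `hmod`, `hGZK`, `hCassels`, `h514`, `hC`, `hCT`} + the non-split control display for every curve `hECns` + MEMO ×6
  {`hKato` (PROOF-MULT, RC-2), `hGS` (PROOF-GS2, RC-4), `hKint`/`hK1` (PROOF-KATO2MULT, RC-32), `hKintSp`/`hK1sp`
  (PROOF-KATO2SPLIT, RC requested 08:48Z)} + the residual `hoff` = optimal curves off SIX roads; and its GUARDED-print
  instance `multUpperHalfAtTwo_of_sixRoads'` (`h41ns' : …_anyPrime_oddLocalDegree`, audit N-1, via
  `multUpperHalfAtTwo_of_fourRoads_of_eulerChar`'s pattern).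

CENSUS (HOME mult/step0/KATO2/census6-all.tsv @14e08c8a, exact; r0 classes): on a road modulo the MEMO binders
1 210 (four roads: 154 optimal-5.14 + 808 sharp non-split + 248 non-split parity) + 436 (road v: split ∧ surjective ∧
`Δ < 0`) + 129 (road vi: split ∧ surjective ∧ `Δ > 0`; «`ord₂ #Ш_an` even» certified 129/129: `v₂ = 4` on 123, `6`
on 6) = **1 775 / 1 969**; residual **194 = 52 small `2`-adic image (no Euler-system door: Rubin's Hyp(ℚ_∞,T) fails,
PROOF-KATO2MULT §7 V3) + 142 «neither» (reducible `E[2]`, optimal curve neither ramified nor odd)** — its content is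
`μ(X(E₀/ℚ_∞)) = 0` (Greenberg's `μ_E = m_E`), not in print; the tower road of `…MultUpperHalfTower.lean` is the only
certificate route in sight (memo §7 V6). A partition certificate, not a proof of the item.

References: [Kato2004Asterisque] Thm. 17.4, 17.11–17.13 (Lemma 17.12 p. 278), 16.4/16.6; [GreenbergLNM1716] §3 Note
(p. 93), §4 pp. 112–113 (split `l_v`), Props. 5.13/5.14; [MazurTateTeitelbaum1986Invent] §I.10, §I.14–15, §II;
[SilvermanAEC2009] Thm. X.4.14; [SilvermanATAEC1994] Thm. V.5.3; [Cesnavicius2018] Thm. 1.2; [Cassels1965ArithmeticVIII];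
[BarreSirieixDiazGramainPhilibert1996Manin]; [Miller2011LMS] Def. 1.1.
-/

set_option autoImplicit false
set_option linter.dupNamespace false

noncomputable section

open scoped Classical MatrixGroups ModularForm

open CongruenceSubgroup WeierstrassCurve Literature.NumberTheory.EllipticCurves
  Literature.NumberTheory.EllipticCurves.ModularForms
  Literature.NumberTheory.EllipticCurves.Greenberg1999
  Literature.NumberTheory.EllipticCurves.Rank1Residual
  Literature.NumberTheory.EllipticCurves.Rank1Residual.Typed
  Literature.NumberTheory.Transcendental
  Summit.BirchSwinnertonDyer.Rank1Residual.X5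

namespace Summit.BirchSwinnertonDyer.BirchSwinnertonDyer.Theorems

/-- `ord_p #Ш` is even for finite `Ш` (Cassels–Tate). Private twin of the Parity/Guarded files' lemma.
[cite: SilvermanAEC2009, Thm. X.4.14] -/
private theorem even_padicValNat_shaOrder'
    (hCT : WeierstrassCurve.exists_casselsTate_pairing (K := ℚ)) (W : WeierstrassCurve ℚ) [W.IsElliptic]
    (hfin : Finite W.sha) (p : ℕ) [Fact p.Prime] : Even (padicValNat p W.shaOrder) := by
  have hfin' : W.ShaFinite := hfin
  obtain ⟨r, hr⟩ := WeierstrassCurve.isSquare_shaOrder_of_casselsTate hCT W hfin'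
  have hpos : 0 < W.shaOrder := W.shaOrder_pos hfin'
  have hr0 : r ≠ 0 := by
    rintro rfl
    rw [hr, mul_zero] at hpos
    exact lt_irrefl 0 hpos
  exact ⟨padicValNat p r, by rw [hr, padicValNat.mul hr0 hr0]⟩

/-! ## §1 Per member: ROAD (vi), the SPLIT PARITY road (slack one + Cassels–Tate) -/

/-- **ROAD (vi) per member — split multiplicative `2`, slack ONE + parity.** For a globally minimal elliptic `W/ℚ` of
analytic rank `0`, SPLIT multiplicative at `2`, with `ρ_{E,2^∞}` surjective: the memo door at slack one (`hK1sp`: for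
the newform `f` at level `N_W`, the split `2`-adic `L`-function `L` of `f`, every cyclotomic datum, every dual datum `D`
and every `ϖ` with `ϖ·Ω_W = Ω⁺_f`, `X` is torsion and `ι(T·g) = 2ϖ·L` for some `g ∈ char_Λ X` — PROOF-KATO2SPLIT Thm. B
at `c_∞ = 2`, i.e. the `Δ > 0` face; on `Δ < 0` it is implied by the sharp door), A236 (`h41sp`), Greenberg–Stevens
at `2` (`hGS`, the `κ₁`-certificate via `O1.kappaOne_of_greenbergStevens`), modularity, GZK, Česnavičius (`hC`:
`ord₂ ϖ = 0` on the irreducible locus, so `ord₂ (2ϖ) ≤ ord₂ ϖ + 1`), Cassels–Tate (`hCT`: `ord₂ #Ш` even) and the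
CERTIFICATE «`#Ш_an(W) = q`, `ord₂ q` even» ⟹ `MissingUpperBoundAt W 2`: the consumer
`O1.upperBound_two_split_of_divisibilityRat` at `ϖ′ = 2ϖ`, `k = 1` gives `ord₂ #Ш ≤ ord₂ q + 1`, and two even integers
that differ by at most one in this direction satisfy `≤`. Split twin of road (iv)
(`missingUpperBoundAt_two_nonsplit_of_katoMultUpTo_one_of_even_of_eulerChar`, p430028). [cite: GreenbergLNM1716, §4 pp. 112–113 (split l_v)]
[cite: MazurTateTeitelbaum1986Invent, §I.14–15 and §II] [cite: SilvermanAEC2009, Thm. X.4.14] [cite: Cesnavicius2018, Thm. 1.2]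
[cite: SilvermanATAEC1994, Thm. V.5.3] [cite: Miller2011LMS, Def. 1.1] -/
theorem missingUpperBoundAt_two_split_of_katoUpToOne_of_even (W : WeierstrassCurve ℚ) [W.IsElliptic]
    [W.IsGloballyMinimal] (h41sp : thm41Analogue_charValue_rankZero_split_baseChange_anyPrime)
    (hGS : greenberg_stevens (W := W) (p := 2))
    (hmod : nonempty_modularParametrizationData) (hGZK : rank_eq_analyticRank_of_analyticRank_le_one)
    (hCT : WeierstrassCurve.exists_casselsTate_pairing (K := ℚ))
    (hC : cesnavicius_not_two_dvd_maninConstant_of_two_dvd_level)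
    (hK1sp : ∀ (κ : ZpExtension ℚ 2) (γ : Field.absoluteGaloisGroup ℚ), κ.IsCyclotomic → κ.IsTopGenerator γ →
      IsCyclotomicVariable 2 γ →
      ∀ [NeZero (W.conductorNorm ℤ)] (f : CuspForm (Gamma0 (W.conductorNorm ℤ)) 2), IsNewformOf W f →
      ∀ ϖ : ℚ, (ϖ : ℝ) * W.realPeriodRat = plusPeriod f →
      ∀ L : PowerSeries ℚ_[2], IsSplitMultPAdicLFunctionOf f 2 L → ∀ D : W.SelmerDualData κ γ,
        D.IsTorsion ∧ ∃ g ∈ D.charIdeal,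
          iwasawaToPowerSeries 2 (PowerSeries.X * g) = PowerSeries.C ((2 * ϖ : ℚ) : ℚ_[2]) * L)
    (hr : W.analyticRank = 0) (hmult : Mult W 2) (hsp : W.HasSplitMultiplicativeReductionAtPrime 2)
    (him : O1.TwoAdicSurjective W) (heven : ∃ q : ℚ, shaAn W = (q : ℂ) ∧ Even (padicValRat 2 q)) :
    MissingUpperBoundAt W 2 := by
  haveI : NeZero (W.conductorNorm ℤ) := ⟨(W.conductorNorm_pos_holds).ne'⟩
  obtain ⟨Dm⟩ := hmod W
  have hf : IsNewformOf W Dm.f := Dm.isNewformOf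
  have hL : W.entireLFunction 1 ≠ 0 :=
    (W.analyticRank_eq_zero_iff_holds hf.hasEntireLFunction).mp hr
  obtain ⟨ϖ, hϖpos, hϖeq, -⟩ := Dm.exists_rat_mul_realPeriodRat_eq_plusPeriod
  obtain ⟨κ, hκ, γ, hγ, hγ'⟩ := exists_isCyclotomic_isTopGenerator_isCyclotomicVariable_holds 2
  obtain ⟨D⟩ := W.nonempty_selmerDualData_holds κ γ hγ
  obtain ⟨L, hLf⟩ := exists_isSplitMultPAdicLFunctionOf hsp hf
  obtain ⟨Dq⟩ := (nonempty_tateParameterData_iff_holds (W := W) (p := 2)).mpr hsp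
  have hlog : padicLog 2 Dq.q ≠ 0 := Dq.padicLog_q_ne_zero MahlerManinPadic_holds
  have hper : padicValRat 2 ϖ = 0 := padicValRat_periodRatio_eq_zero_of_irr_two hC W hmult
    (O1.irr_two_of_twoAdicSurjective W him) Dm.f hf ϖ hϖeq
  have hϖ0 : ϖ ≠ 0 := hϖpos.ne'
  have h2ϖ0 : (2 * ϖ : ℚ) ≠ 0 := mul_ne_zero two_ne_zero hϖ0
  have h22 : padicValRat 2 (2 : ℚ) = 1 := by exact_mod_cast padicValRat.self (p := 2) one_lt_two
  have hk : padicValRat 2 (2 * ϖ) ≤ padicValRat 2 ϖ + (1 : ℕ) := by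
    rw [padicValRat.mul two_ne_zero hϖ0, h22]
    push_cast
    linarith
  have hdiv := hK1sp κ γ hκ hγ hγ' Dm.f hf ϖ hϖeq L hLf D
  obtain ⟨q, hq, hle⟩ := O1.upperBound_two_split_of_divisibilityRat W
    (O1.twoAdicEulerCharRankZeroSplitMult_zero_of_greenberg W h41sp) hGZK hmult hsp hL hκ hγ hγ' hf Dq hlog
    (O1.kappaOne_of_greenbergStevens W hGS hr hf hLf Dq) D ϖ hϖeq h2ϖ0 1 hk
    (by simpa only [Rat.cast_mul, Rat.cast_ofNat] using hdiv)
  have hle' : (padicValNat 2 W.shaOrder : ℤ) ≤ padicValRat 2 q + 1 := by simpa using hle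
  have hfin : Finite W.sha := (hGZK W (by rw [hr]; exact zero_le_one)).2
  have hevenSha : Even ((padicValNat 2 W.shaOrder : ℕ) : ℤ) :=
    (even_padicValNat_shaOrder' hCT W hfin 2).natCast
  obtain ⟨u, hu⟩ := hevenSha
  obtain ⟨q', hq', v, hv⟩ := heven
  have hqq : q' = q := by exact_mod_cast hq'.symm.trans hq
  subst hqq
  exact ⟨q', hq, by omega⟩

/-! ## §2 The class theorems: roads (v) and (vi) at ONE member, Cassels to every member -/

/-- **ROAD (v) for the class** — twin of `missingUpperBoundAt_two_mult_of_katoIntMember` (p424960) at a SPLIT `2`. For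
`W` of analytic rank `0` multiplicative at `2` and an isogenous globally minimal member `W₁ ~_ℚ W` that is SPLIT
multiplicative at `2` with `ρ_{E₁,2^∞}` surjective and `Δ_{W₁} < 0`, carrying the door `O1.KatoDivisibilityAtTwoSplitMultInt
W₁` (T-KATO2-SPMULT, MEMO PROOF-KATO2SPLIT): `MissingUpperBoundAt W 2` from PRINT {A236 `h41sp`, modularity, GZK,
Cassels} + the tree's named fact `greenberg_stevens W₁ 2` (`hGS`, MEMO PROOF-GS2 RC-4). Per member by
`O1.missingUpperBoundAt_two_split_of_katoInt` (p433154; no period datum needed), then Cassels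
(`missingUpperBoundAt_two_of_isogenous_member`). [cite: GreenbergLNM1716, §4 pp. 112–113] [cite: Cassels1965ArithmeticVIII]
[cite: Miller2011LMS, Def. 1.1] -/
theorem missingUpperBoundAt_two_mult_of_katoIntSplitMember
    (h41sp : thm41Analogue_charValue_rankZero_split_baseChange_anyPrime)
    (hmod : nonempty_modularParametrizationData)
    (hGZK : rank_eq_analyticRank_of_analyticRank_le_one)
    (hCassels : bsdRHS_eq_of_isIsogenous)
    (hGS : ∀ (W : WeierstrassCurve ℚ) [W.IsElliptic] [W.IsGloballyMinimal],
      W.HasSplitMultiplicativeReductionAtPrime 2 → greenberg_stevens (W := W) (p := 2))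
    (W : WeierstrassCurve ℚ) [W.IsElliptic] [W.IsGloballyMinimal]
    (hr : W.analyticRank = 0) (hmult : Mult W 2)
    (W₁ : WeierstrassCurve ℚ) [W₁.IsElliptic] [W₁.IsGloballyMinimal] (hiso : IsIsogenous W W₁)
    (hsp₁ : W₁.HasSplitMultiplicativeReductionAtPrime 2) (him₁ : O1.TwoAdicSurjective W₁) (hΔ₁ : W₁.Δ < 0)
    (hKint₁ : O1.KatoDivisibilityAtTwoSplitMultInt W₁) : MissingUpperBoundAt W 2 := by
  have hmult₁ : Mult W₁ 2 :=
    Summit.BirchSwinnertonDyer.Rank1Residual.X2.IsogenyQuotientLine.hasMultiplicativeReductionAtPrime_of_isIsogenous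
      hiso hmult
  have hr₁ : W₁.analyticRank = 0 := (analyticRank_eq_of_isIsogenous' hiso).symm.trans hr
  exact missingUpperBoundAt_two_of_isogenous_member hmod hGZK hCassels W hr W₁ hiso
    (O1.missingUpperBoundAt_two_split_of_katoInt W₁ h41sp (hGS W₁ hsp₁) hmod hGZK hKint₁ hr₁ hmult₁ hsp₁ him₁ hΔ₁)

/-- **ROAD (vi) for the class** — twin of `missingUpperBoundAt_two_mult_of_katoMultUpToOneMember` (p427239) at a
SPLIT `2`: one member `W₁ ~_ℚ W` SPLIT multiplicative at `2` with `ρ_{E₁,2^∞}` surjective, the slack-one split door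
at `W₁` (`hK1sp₁`, shape of §1) and the certificate «`ord₂ #Ш_an(W₁)` even» ⟹ `MissingUpperBoundAt W 2` (PRINT {A236,
modularity, GZK, Cassels, Česnavičius, Cassels–Tate} + `greenberg_stevens W₁ 2`). §1 at `W₁`, then Cassels.
[cite: GreenbergLNM1716, §4 pp. 112–113] [cite: SilvermanAEC2009, Thm. X.4.14] [cite: Cassels1965ArithmeticVIII] [cite: Miller2011LMS, Def. 1.1] -/
theorem missingUpperBoundAt_two_mult_of_katoUpToOneSplitMember
    (h41sp : thm41Analogue_charValue_rankZero_split_baseChange_anyPrime)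
    (hmod : nonempty_modularParametrizationData)
    (hGZK : rank_eq_analyticRank_of_analyticRank_le_one)
    (hCassels : bsdRHS_eq_of_isIsogenous)
    (hC : cesnavicius_not_two_dvd_maninConstant_of_two_dvd_level)
    (hCT : WeierstrassCurve.exists_casselsTate_pairing (K := ℚ))
    (hGS : ∀ (W : WeierstrassCurve ℚ) [W.IsElliptic] [W.IsGloballyMinimal],
      W.HasSplitMultiplicativeReductionAtPrime 2 → greenberg_stevens (W := W) (p := 2))
    (W : WeierstrassCurve ℚ) [W.IsElliptic] [W.IsGloballyMinimal]
    (hr : W.analyticRank = 0) (hmult : Mult W 2)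
    (W₁ : WeierstrassCurve ℚ) [W₁.IsElliptic] [W₁.IsGloballyMinimal] (hiso : IsIsogenous W W₁)
    (hsp₁ : W₁.HasSplitMultiplicativeReductionAtPrime 2) (him₁ : O1.TwoAdicSurjective W₁)
    (hK1sp₁ : ∀ (κ : ZpExtension ℚ 2) (γ : Field.absoluteGaloisGroup ℚ), κ.IsCyclotomic → κ.IsTopGenerator γ →
      IsCyclotomicVariable 2 γ →
      ∀ [NeZero (W₁.conductorNorm ℤ)] (f : CuspForm (Gamma0 (W₁.conductorNorm ℤ)) 2), IsNewformOf W₁ f →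
      ∀ ϖ : ℚ, (ϖ : ℝ) * W₁.realPeriodRat = plusPeriod f →
      ∀ L : PowerSeries ℚ_[2], IsSplitMultPAdicLFunctionOf f 2 L → ∀ D : W₁.SelmerDualData κ γ,
        D.IsTorsion ∧ ∃ g ∈ D.charIdeal,
          iwasawaToPowerSeries 2 (PowerSeries.X * g) = PowerSeries.C ((2 * ϖ : ℚ) : ℚ_[2]) * L)
    (heven₁ : ∃ q : ℚ, shaAn W₁ = (q : ℂ) ∧ Even (padicValRat 2 q)) : MissingUpperBoundAt W 2 := by
  have hmult₁ : Mult W₁ 2 :=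
    Summit.BirchSwinnertonDyer.Rank1Residual.X2.IsogenyQuotientLine.hasMultiplicativeReductionAtPrime_of_isIsogenous
      hiso hmult
  have hr₁ : W₁.analyticRank = 0 := (analyticRank_eq_of_isIsogenous' hiso).symm.trans hr
  exact missingUpperBoundAt_two_of_isogenous_member hmod hGZK hCassels W hr W₁ hiso
    (missingUpperBoundAt_two_split_of_katoUpToOne_of_even W₁ h41sp (hGS W₁ hsp₁) hmod hGZK hCT hC hK1sp₁ hr₁ hmult₁
      hsp₁ him₁ heven₁)

/-! ## §3 The crux decl from SIX roads, control slot abstract, and its guarded-print instance -/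

/-! ### Import refactor H3 (director-bsd 2026-08-26, standing build rule: only an item closer may import a
`…Theses.<Route>` file). The item-closing reductions of this module that CONCLUDE the route declaration
`Theses.ByReductionTypeAtTwo.MultUpperHalfAtTwo` (`multUpperHalfAtTwo_of_sixRoads_of_eulerChar`, `multUpperHalfAtTwo_of_sixRoads'`) moved VERBATIM to the thin leaf
`Theorems/ByReductionTypeAtTwoMultUpperHalfCloses.lean`; every other declaration is unchanged, so the
certificate towers importing this file (cone ≈ 1 100 modules, 579 under `Rank1Residual/X5/`) no longer rebuild on
a route edit. -/

end Summit.BirchSwinnertonDyer.BirchSwinnertonDyer.Theorems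

end
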